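import Literature.MathematicalPhysics.QuantumLattice.GrassmannWeightedEffectiveActionTruncation
import Literature.MathematicalPhysics.QuantumLattice.GrassmannFlowStep
import HarnessLib

/-!
# One step of the flow of the kernels in the decay-weighted norms

Topic `MathematicalPhysics/QuantumLattice`; the WEIGHTED form of `GrassmannGaussConvKernelBound.lean` (the Wick / first-order
part `e^{Δ_C}V - V` of the renormalisation-group map, kernel by kernel) and of `GrassmannFlowStep.lean` (its packaging with
the second-order remainder), Benfatto–Giuliani–Mastropietro 2006, (2.86)–(2.90) with the decay bookkeeping of §3.  For a
tree weight `wt` on label sets (`SubmultiplicativeTreeWeight.lean`): a Wick contraction deletes two legs, so the label set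
of the output is a SUBSET of that of the input and the weight only decreases (`IsTreeWeight.mono`) — the first-order part
of the flow costs the sup norm `s` of the covariance and nothing else, in the weighted norms as in the unweighted ones:

* `wt_image_le_wt_image_snoc_snoc` — `wt(X) ≤ wt(X, B, A)`;
* **`sum_wt_norm_kernel_grassmannLaplacian_le`** — `Σ_{X : X_i = w} wt(X) ‖kernel (Δ_C W) m X‖ ≤ ((m+1)(m+2)/2) · s ·
  Σ_{Z : Z_i = w} wt(Z) ‖kernel W (m+2) Z‖`; `sum_wt_norm_kernel_grassmannLaplacian_pow_le` (`j` contractions);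
  **`sum_wt_norm_kernel_gaussConv_sub_le`** (`e^{Δ_C}W - W`);
* **`sum_wt_norm_kernel_effAction_le_flow`** — `Σ_{W : W_i = w} wt(W) ‖kernel (effAction C V) m W‖ ≤ N(m) +
  Σ_{1 ≤ j < k} ((m+2j)!/(m! j! 2^j)) s^j N(m+2j) + ρ^{-m} e‖V‖_h θ/(1-θ)` with `wt`-weighted pinned norms `N` of all the
  kernels of `V` and pair-weighted row sums `≤ α` of `C`; **`sum_wt_norm_kernel_effAction_sub_le_of_top`** — the top
  degree moves only at second order, in the weighted norms.

Everything is proved; no definition, no named fact.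

## Sources

G. Benfatto, A. Giuliani, V. Mastropietro, Ann. Henri Poincaré 7 (2006) 809–898, (2.86)–(2.90), §3 (3.2)–(3.8)
[`BenfattoGiulianiMastropietro2006`]; K. Gawȩdzki, A. Kupiainen, Comm. Math. Phys. 102 (1985) 1–30, §3
[`GawedzkiKupiainen1985GrossNeveu`]; M. Salmhofer, *Renormalization* (1999), §4.3 [`Salmhofer1999`].
-/

noncomputable section

namespace Literature.MathematicalPhysics.QuantumLattice

open GrassmannAlgebra Finset Literature.Probability.LatticeModels Literature.Probability.LatticeModels.BattleFederbush
open scoped InnerProductSpace Nat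

variable {𝕜 : Type*} [RCLike 𝕜] {Γ : Type*} [Fintype Γ] [DecidableEq Γ] (C : Matrix Γ Γ 𝕜) {wt : Finset Γ → ℝ}

/-! ### The weighted Wick bound -/

omit [Fintype Γ] in
/-- **Deleting two legs only decreases the weight**: `wt(X) ≤ wt(X, B, A)`. [folklore] -/
theorem wt_image_le_wt_image_snoc_snoc (hwt : IsTreeWeight wt) {m : ℕ} (X : Fin m → Γ) (B A : Γ) :
    wt (univ.image X) ≤ wt (univ.image (Fin.snoc (Fin.snoc X B : Fin (m + 1) → Γ) A)) := by
  refine hwt.mono fun a ha => ?_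
  obtain ⟨j, -, rfl⟩ := mem_image.1 ha
  refine mem_image.2 ⟨Fin.castSucc (Fin.castSucc j), mem_univ _, ?_⟩
  simp only [Fin.snoc_castSucc]

/-- **The weighted Wick bound for one Laplacian, one output leg pinned**: if `‖C(A,B)‖ ≤ s` then
`Σ_{X : X_i = w} wt(X) ‖kernel (Δ_C W) m X‖ ≤ ((m+1)(m+2)/2) · s · Σ_{Z : Z_i = w} wt(Z) ‖kernel W (m+2) Z‖`.
[cite: BenfattoGiulianiMastropietro2006, (2.86)-(2.90)] -/
theorem sum_wt_norm_kernel_grassmannLaplacian_le (hwt : IsTreeWeight wt) {s : ℝ} (hs : ∀ A B, ‖C A B‖ ≤ s)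
    (W : GrassmannAlgebra 𝕜 Γ) (m : ℕ) (i : Fin m) (w : Γ) :
    ∑ X ∈ univ.filter (fun X : Fin m → Γ => X i = w), wt (univ.image X) * ‖kernel 𝕜 (grassmannLaplacian 𝕜 C W) m X‖ ≤
      (((m + 1) * (m + 2) : ℕ) : ℝ) / 2 * s *
        ∑ Z ∈ univ.filter (fun Z : Fin (m + 1 + 1) → Γ => Z (Fin.castSucc (Fin.castSucc i)) = w),
          wt (univ.image Z) * ‖kernel 𝕜 W (m + 2) Z‖ := by
  have hs0 : 0 ≤ s := le_trans (norm_nonneg _) (hs w w)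
  have hcoef : ‖(((((m + 1) * (m + 2) : ℕ) : ℚ) / 2) • (1 : 𝕜))‖ = (((m + 1) * (m + 2) : ℕ) : ℝ) / 2 := by
    rw [Rat.smul_one_eq_cast, ← RCLike.ofReal_ratCast, RCLike.norm_ofReal]
    push_cast
    exact abs_of_nonneg (by positivity)
  -- pointwise
  have hpt : ∀ X : Fin m → Γ, wt (univ.image X) * ‖kernel 𝕜 (grassmannLaplacian 𝕜 C W) m X‖ ≤
      (((m + 1) * (m + 2) : ℕ) : ℝ) / 2 * s * ∑ A, ∑ B, wt (univ.image (Fin.snoc (Fin.snoc X B : Fin (m + 1) → Γ) A)) *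
        ‖kernel 𝕜 W (m + 2) (Fin.snoc (Fin.snoc X B : Fin (m + 1) → Γ) A)‖ := by
    intro X
    rw [kernel_grassmannLaplacian, norm_mul, hcoef]
    set c : ℝ := (((m + 1) * (m + 2) : ℕ) : ℝ) / 2 with hc
    have hc0 : 0 ≤ c := by positivity
    suffices hmain : wt (univ.image X) * ‖∑ A, ∑ B, C A B * kernel 𝕜 W (m + 2) (Fin.snoc (Fin.snoc X B : Fin (m + 1) → Γ) A)‖ ≤
        s * ∑ A, ∑ B, wt (univ.image (Fin.snoc (Fin.snoc X B : Fin (m + 1) → Γ) A)) *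
          ‖kernel 𝕜 W (m + 2) (Fin.snoc (Fin.snoc X B : Fin (m + 1) → Γ) A)‖ by
      calc wt (univ.image X) * (c * ‖∑ A, ∑ B, C A B * kernel 𝕜 W (m + 2) (Fin.snoc (Fin.snoc X B : Fin (m + 1) → Γ) A)‖)
          = c * (wt (univ.image X) * ‖∑ A, ∑ B, C A B * kernel 𝕜 W (m + 2) (Fin.snoc (Fin.snoc X B : Fin (m + 1) → Γ) A)‖) := by ring
        _ ≤ c * (s * ∑ A, ∑ B, wt (univ.image (Fin.snoc (Fin.snoc X B : Fin (m + 1) → Γ) A)) *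
              ‖kernel 𝕜 W (m + 2) (Fin.snoc (Fin.snoc X B : Fin (m + 1) → Γ) A)‖) := mul_le_mul_of_nonneg_left hmain hc0
        _ = _ := by ring
    refine (mul_le_mul_of_nonneg_left (norm_sum_le _ _) (hwt.nonneg _)).trans ?_
    rw [mul_sum, mul_sum]
    refine sum_le_sum fun A _ => ?_
    refine (mul_le_mul_of_nonneg_left (norm_sum_le _ _) (hwt.nonneg _)).trans ?_
    rw [mul_sum, mul_sum]
    refine sum_le_sum fun B _ => ?_
    rw [norm_mul]
    calc wt (univ.image X) * (‖C A B‖ * ‖kernel 𝕜 W (m + 2) (Fin.snoc (Fin.snoc X B : Fin (m + 1) → Γ) A)‖)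
        ≤ wt (univ.image (Fin.snoc (Fin.snoc X B : Fin (m + 1) → Γ) A)) * (s * ‖kernel 𝕜 W (m + 2) (Fin.snoc (Fin.snoc X B : Fin (m + 1) → Γ) A)‖) :=
          mul_le_mul (wt_image_le_wt_image_snoc_snoc hwt X B A) (mul_le_mul_of_nonneg_right (hs A B) (norm_nonneg _))
            (mul_nonneg (norm_nonneg _) (norm_nonneg _)) (hwt.nonneg _)
      _ = s * (wt (univ.image (Fin.snoc (Fin.snoc X B : Fin (m + 1) → Γ) A)) * ‖kernel 𝕜 W (m + 2) (Fin.snoc (Fin.snoc X B : Fin (m + 1) → Γ) A)‖) := by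
          ring
  refine (sum_le_sum fun X _ => hpt X).trans (le_of_eq ?_)
  rw [← mul_sum, sum_filter_sum_sum_snoc_snoc_eq (fun Z => wt (univ.image Z) * ‖kernel 𝕜 W (m + 2) Z‖) i w]

/-- **The weighted Wick bound for `j` Laplacians**: with `wt`-weighted pinned norms `N(n)` of ALL the kernels of `W`,
`Σ_{X : X_i = w} wt(X) ‖kernel (Δ_C^j W) m X‖ ≤ ((m+2j)!/(m! 2^j)) s^j N(m+2j)`. [cite: BenfattoGiulianiMastropietro2006, (2.86)-(2.90)] -/
theorem sum_wt_norm_kernel_grassmannLaplacian_pow_le (hwt : IsTreeWeight wt) {s : ℝ} (hs : ∀ A B, ‖C A B‖ ≤ s)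
    (W : GrassmannAlgebra 𝕜 Γ) (N : ℕ → ℝ)
    (hN : ∀ (n : ℕ) (p : Fin n) (w : Γ), ∑ Z ∈ univ.filter (fun Z : Fin n → Γ => Z p = w), wt (univ.image Z) * ‖kernel 𝕜 W n Z‖ ≤ N n) :
    ∀ (j m : ℕ) (i : Fin m) (w : Γ),
      ∑ X ∈ univ.filter (fun X : Fin m → Γ => X i = w), wt (univ.image X) * ‖kernel 𝕜 ((grassmannLaplacian 𝕜 C ^ j) W) m X‖ ≤
        ((m + 2 * j)! : ℝ) / ((m ! : ℝ) * 2 ^ j) * s ^ j * N (m + 2 * j)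
  | 0, m, i, w => by
    have h := hN m i w
    simp only [pow_zero, Module.End.one_apply, Nat.mul_zero, Nat.add_zero, mul_one]
    rwa [div_self (by positivity), one_mul]
  | j + 1, m, i, w => by
    have hs0 : 0 ≤ s := le_trans (norm_nonneg _) (hs w w)
    rw [pow_succ', Module.End.mul_apply]
    refine (sum_wt_norm_kernel_grassmannLaplacian_le C hwt hs _ m i w).trans ?_
    have ih := sum_wt_norm_kernel_grassmannLaplacian_pow_le hwt hs W N hN j (m + 1 + 1) (Fin.castSucc (Fin.castSucc i)) w
    refine (mul_le_mul_of_nonneg_left ih (by positivity)).trans (le_of_eq ?_)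
    have hmf : ((m + 1 + 1)! : ℝ) = (m + 1 + 1 : ℝ) * ((m + 1 : ℝ) * (m ! : ℝ)) := by
      rw [Nat.factorial_succ, Nat.factorial_succ]; push_cast; ring
    rw [show m + 1 + 1 + 2 * j = m + 2 * (j + 1) by ring, hmf]
    have hm0 : (m ! : ℝ) ≠ 0 := by positivity
    push_cast
    field_simp
    ring

/-- **The first-order part of the flow in the weighted norms, kernel by kernel**: if `Δ_C^k = 0`, `‖C(A,B)‖ ≤ s`, then for
every degree `m` and pinned output leg,
`Σ_{X : X_i = w} wt(X) ‖kernel (e^{Δ_C}W - W) m X‖ ≤ Σ_{1 ≤ j < k} ((m+2j)!/(m! j! 2^j)) s^j N(m+2j)` with weighted pinned norms `N`.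
[cite: BenfattoGiulianiMastropietro2006, (2.86)-(2.90)] -/
theorem sum_wt_norm_kernel_gaussConv_sub_le (hwt : IsTreeWeight wt) {k : ℕ} (hk : grassmannLaplacian 𝕜 C ^ k = 0) {s : ℝ}
    (hs : ∀ A B, ‖C A B‖ ≤ s) (W : GrassmannAlgebra 𝕜 Γ) (N : ℕ → ℝ)
    (hN : ∀ (n : ℕ) (p : Fin n) (w : Γ), ∑ Z ∈ univ.filter (fun Z : Fin n → Γ => Z p = w), wt (univ.image Z) * ‖kernel 𝕜 W n Z‖ ≤ N n)
    (m : ℕ) (i : Fin m) (w : Γ) :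
    ∑ X ∈ univ.filter (fun X : Fin m → Γ => X i = w), wt (univ.image X) * ‖kernel 𝕜 (gaussConv 𝕜 C W - W) m X‖ ≤
      ∑ j ∈ Ico 1 k, ((m + 2 * j)! : ℝ) / ((m ! : ℝ) * (j ! : ℝ) * 2 ^ j) * s ^ j * N (m + 2 * j) := by
  have hs0 : 0 ≤ s := le_trans (norm_nonneg _) (hs w w)
  -- `e^{Δ}W - W = Σ_{1 ≤ j < k} (j!)⁻¹ Δ^j W`
  have hexp : gaussConv 𝕜 C W - W = ∑ j ∈ Ico 1 k, ((j ! : ℚ)⁻¹) • (grassmannLaplacian 𝕜 C ^ j) W := by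
    rcases Nat.eq_zero_or_pos k with rfl | hkpos
    · have h1 : (1 : Module.End 𝕜 (GrassmannAlgebra 𝕜 Γ)) = 0 := by rwa [pow_zero] at hk
      have hW : W = 0 := by simpa using congrArg (fun T : Module.End 𝕜 (GrassmannAlgebra 𝕜 Γ) => T W) h1
      simp [hW]
    · rw [gaussConv, IsNilpotent.exp_eq_sum hk, LinearMap.coe_sum, Finset.sum_apply, range_eq_Ico,
        sum_eq_sum_Ico_succ_bot hkpos]
      simp only [LinearMap.smul_apply, pow_zero, Nat.factorial_zero, Nat.cast_one, inv_one, one_smul,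
        Module.End.one_apply, add_sub_cancel_left]
  rw [hexp]
  calc ∑ X ∈ univ.filter (fun X : Fin m → Γ => X i = w),
        wt (univ.image X) * ‖kernel 𝕜 (∑ j ∈ Ico 1 k, ((j ! : ℚ)⁻¹) • (grassmannLaplacian 𝕜 C ^ j) W) m X‖
      ≤ ∑ X ∈ univ.filter (fun X : Fin m → Γ => X i = w),
          ∑ j ∈ Ico 1 k, (j ! : ℝ)⁻¹ * (wt (univ.image X) * ‖kernel 𝕜 ((grassmannLaplacian 𝕜 C ^ j) W) m X‖) := by
        refine sum_le_sum fun X _ => ?_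
        rw [kernel_sum]
        refine (mul_le_mul_of_nonneg_left (norm_sum_le _ _) (hwt.nonneg _)).trans (le_of_eq ?_)
        rw [mul_sum]
        refine sum_congr rfl fun j _ => ?_
        rw [← Rat.cast_smul_eq_qsmul 𝕜, kernel_smul, norm_mul, Rat.cast_inv, Rat.cast_natCast, norm_inv,
          RCLike.norm_natCast]
        ring
    _ = ∑ j ∈ Ico 1 k, (j ! : ℝ)⁻¹ * ∑ X ∈ univ.filter (fun X : Fin m → Γ => X i = w),
          wt (univ.image X) * ‖kernel 𝕜 ((grassmannLaplacian 𝕜 C ^ j) W) m X‖ := by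
        rw [sum_comm]
        exact sum_congr rfl fun j _ => by rw [mul_sum]
    _ ≤ ∑ j ∈ Ico 1 k, (j ! : ℝ)⁻¹ * (((m + 2 * j)! : ℝ) / ((m ! : ℝ) * 2 ^ j) * s ^ j * N (m + 2 * j)) :=
        sum_le_sum fun j _ => mul_le_mul_of_nonneg_left
          (sum_wt_norm_kernel_grassmannLaplacian_pow_le C hwt hs W N hN j m i w) (by positivity)
    _ = _ := sum_congr rfl fun j _ => by
        have hj : (j ! : ℝ) ≠ 0 := by positivity
        have hm : (m ! : ℝ) ≠ 0 := by positivity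
        field_simp

/-! ### The weighted flow step -/

/-- **One step of the flow of the kernels in the weighted norms** (BGM 2006, (2.86)–(2.90) with §3): for a tree weight
`wt`, with `θ = eα‖V‖_h/κ² < 1`, `‖C(A,B)‖ ≤ s`, `Δ_C^k = 0`, `wt`-weighted pinned norms `N(n)` of all the kernels of `V`
and pair-weighted row and column sums of `C` at most `α`: for every degree `m ≥ 1` and pinned output leg,
`Σ_{W : W_i = w} wt(W) ‖kernel (effAction C V) m W‖ ≤ N(m) + Σ_{1 ≤ j < k} ((m+2j)!/(m! j! 2^j)) s^j N(m+2j) + ρ^{-m} e‖V‖_h θ/(1-θ)`.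
[cite: BenfattoGiulianiMastropietro2006, (2.86)-(2.90) and §3 (3.2)-(3.8)] -/
theorem sum_wt_norm_kernel_effAction_le_flow {E : Type*} [NormedAddCommGroup E] [InnerProductSpace 𝕜 E] (hwt : IsTreeWeight wt)
    (q : Γ → Bool) (hC : ∀ X Y, q X = q Y → C X Y = 0) (f g : Γ → E) {κ : ℝ} (hκ : 0 < κ)
    (hf : ∀ X, q X = true → ‖f X‖ ≤ κ) (hg : ∀ Y, q Y = false → ‖g Y‖ ≤ κ)
    (hG : ∀ X Y, q X = true → q Y = false → contr 𝕜 C X Y = ⟪f X, g Y⟫_𝕜)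
    (V : GrassmannAlgebra 𝕜 Γ) (hV : V ∈ evenPart 𝕜 Γ) (hV0 : constPart 𝕜 V = 0) (N : ℕ → ℝ) (hN0 : ∀ n, 0 ≤ N n)
    (hN : ∀ (n : ℕ) (p : Fin n) (w : Γ), ∑ Y ∈ univ.filter (fun Y : Fin n → Γ => Y p = w), wt (univ.image Y) * ‖kernel 𝕜 V n Y‖ ≤ N n)
    {α : ℝ} (hα : 0 < α) (hrow : ∀ X, ∑ Y, ‖C X Y‖ * wt {X, Y} ≤ α) (hcol : ∀ Y, ∑ X, ‖C X Y‖ * wt {X, Y} ≤ α) {ρ : ℝ} (hρ : 0 < ρ)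
    (hθ : Real.exp 1 * α * normV Γ κ ρ (fun m' => N (2 * m')) / κ ^ 2 < 1)
    {s : ℝ} (hs : ∀ A B, ‖C A B‖ ≤ s) {k : ℕ} (hk : grassmannLaplacian 𝕜 C ^ k = 0)
    {m : ℕ} (hm : 0 < m) (i : Fin m) (w : Γ) :
    ∑ W ∈ univ.filter (fun W : Fin m → Γ => W i = w), wt (univ.image W) * ‖kernel 𝕜 (effAction 𝕜 C V) m W‖ ≤
      N m + ∑ j ∈ Ico 1 k, ((m + 2 * j)! : ℝ) / ((m ! : ℝ) * (j ! : ℝ) * 2 ^ j) * s ^ j * N (m + 2 * j) +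
        ρ⁻¹ ^ m * (Real.exp 1 * normV Γ κ ρ (fun m' => N (2 * m'))) *
          (Real.exp 1 * α * normV Γ κ ρ (fun m' => N (2 * m')) / κ ^ 2) /
            (1 - Real.exp 1 * α * normV Γ κ ρ (fun m' => N (2 * m')) / κ ^ 2) := by
  -- the three pieces
  have h1 := hN m i w
  have h2 := sum_wt_norm_kernel_gaussConv_sub_le C hwt hk hs V N hN m i w
  obtain ⟨-, h3⟩ := sum_wt_norm_kernel_effAction_sub_gaussConv_le C hwt q hC f g hκ hf hg hG V hV hV0 (fun m' => N (2 * m'))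
    (fun m' => hN0 _) (fun m' j w' => (le_of_eq (sum_congr rfl fun Y _ => mul_comm _ _)).trans (hN (2 * m') j w')) hα hrow hcol hρ hθ
  have h3' := h3 hm i w
  -- `𝒱' = V + (e^{Δ}V - V) + (𝒱' - e^{Δ}V)`
  have hsplit : ∀ W, kernel 𝕜 (effAction 𝕜 C V) m W = kernel 𝕜 V m W + kernel 𝕜 (gaussConv 𝕜 C V - V) m W +
      kernel 𝕜 (effAction 𝕜 C V - gaussConv 𝕜 C V) m W := by
    intro W
    rw [← kernel_add, ← kernel_add]
    congr 1
    abel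
  calc ∑ W ∈ univ.filter (fun W : Fin m → Γ => W i = w), wt (univ.image W) * ‖kernel 𝕜 (effAction 𝕜 C V) m W‖
      ≤ ∑ W ∈ univ.filter (fun W : Fin m → Γ => W i = w), (wt (univ.image W) * ‖kernel 𝕜 V m W‖ +
          wt (univ.image W) * ‖kernel 𝕜 (gaussConv 𝕜 C V - V) m W‖ +
          wt (univ.image W) * ‖kernel 𝕜 (effAction 𝕜 C V - gaussConv 𝕜 C V) m W‖) :=
        sum_le_sum fun W _ => by
          rw [hsplit W, ← mul_add, ← mul_add]
          exact mul_le_mul_of_nonneg_left norm_add₃_le (hwt.nonneg _)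
    _ = _ := by rw [sum_add_distrib, sum_add_distrib]
    _ ≤ _ := add_le_add (add_le_add h1 h2) h3'

/-- **The top degree does not move at first order, in the weighted norms**: if `V` has no kernels above degree `m`
(`N(n) = 0` for `n > m`), then `Σ_{W : W_i = w} wt(W) ‖kernel (effAction C V - V) m W‖ ≤ ρ^{-m} e‖V‖_h θ/(1-θ)`.
[cite: BenfattoGiulianiMastropietro2006, (2.86)-(2.90) and §3 (3.2)-(3.8)] -/
theorem sum_wt_norm_kernel_effAction_sub_le_of_top {E : Type*} [NormedAddCommGroup E] [InnerProductSpace 𝕜 E] (hwt : IsTreeWeight wt)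
    (q : Γ → Bool) (hC : ∀ X Y, q X = q Y → C X Y = 0) (f g : Γ → E) {κ : ℝ} (hκ : 0 < κ)
    (hf : ∀ X, q X = true → ‖f X‖ ≤ κ) (hg : ∀ Y, q Y = false → ‖g Y‖ ≤ κ)
    (hG : ∀ X Y, q X = true → q Y = false → contr 𝕜 C X Y = ⟪f X, g Y⟫_𝕜)
    (V : GrassmannAlgebra 𝕜 Γ) (hV : V ∈ evenPart 𝕜 Γ) (hV0 : constPart 𝕜 V = 0) (N : ℕ → ℝ) (hN0 : ∀ n, 0 ≤ N n)
    (hN : ∀ (n : ℕ) (p : Fin n) (w : Γ), ∑ Y ∈ univ.filter (fun Y : Fin n → Γ => Y p = w), wt (univ.image Y) * ‖kernel 𝕜 V n Y‖ ≤ N n)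
    {α : ℝ} (hα : 0 < α) (hrow : ∀ X, ∑ Y, ‖C X Y‖ * wt {X, Y} ≤ α) (hcol : ∀ Y, ∑ X, ‖C X Y‖ * wt {X, Y} ≤ α) {ρ : ℝ} (hρ : 0 < ρ)
    (hθ : Real.exp 1 * α * normV Γ κ ρ (fun m' => N (2 * m')) / κ ^ 2 < 1)
    {m : ℕ} (hm : 0 < m) (htop : ∀ n, m < n → N n = 0) (i : Fin m) (w : Γ) :
    ∑ W ∈ univ.filter (fun W : Fin m → Γ => W i = w), wt (univ.image W) * ‖kernel 𝕜 (effAction 𝕜 C V - V) m W‖ ≤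
      ρ⁻¹ ^ m * (Real.exp 1 * normV Γ κ ρ (fun m' => N (2 * m'))) *
        (Real.exp 1 * α * normV Γ κ ρ (fun m' => N (2 * m')) / κ ^ 2) /
          (1 - Real.exp 1 * α * normV Γ κ ρ (fun m' => N (2 * m')) / κ ^ 2) := by
  obtain ⟨k, hk⟩ := isNilpotent_grassmannLaplacian 𝕜 C
  -- a sup bound for `C`: every entry is at most a (weighted) row sum, `wt ≥ 1`
  have hs : ∀ A B, ‖C A B‖ ≤ α := fun A B =>
    ((le_mul_of_one_le_right (norm_nonneg _) (hwt.one_le _)).trans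
      (single_le_sum (f := fun Y => ‖C A Y‖ * wt {A, Y}) (fun Y _ => mul_nonneg (norm_nonneg _) (hwt.nonneg _)) (mem_univ B))).trans
        (hrow A)
  have h2 := sum_wt_norm_kernel_gaussConv_sub_le C hwt hk hs V N hN m i w
  obtain ⟨-, h3⟩ := sum_wt_norm_kernel_effAction_sub_gaussConv_le C hwt q hC f g hκ hf hg hG V hV hV0 (fun m' => N (2 * m'))
    (fun m' => hN0 _) (fun m' j w' => (le_of_eq (sum_congr rfl fun Y _ => mul_comm _ _)).trans (hN (2 * m') j w')) hα hrow hcol hρ hθ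
  have h3' := h3 hm i w
  -- the Wick sum vanishes: no higher kernels
  have hzero : ∑ j ∈ Ico 1 k, ((m + 2 * j)! : ℝ) / ((m ! : ℝ) * (j ! : ℝ) * 2 ^ j) * α ^ j * N (m + 2 * j) = 0 :=
    sum_eq_zero fun j hj => by rw [htop (m + 2 * j) (by have := (mem_Ico.1 hj).1; omega), mul_zero]
  rw [hzero] at h2
  have hsplit : ∀ W, kernel 𝕜 (effAction 𝕜 C V - V) m W = kernel 𝕜 (gaussConv 𝕜 C V - V) m W +
      kernel 𝕜 (effAction 𝕜 C V - gaussConv 𝕜 C V) m W := by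
    intro W
    rw [← kernel_add]
    congr 1
    abel
  calc ∑ W ∈ univ.filter (fun W : Fin m → Γ => W i = w), wt (univ.image W) * ‖kernel 𝕜 (effAction 𝕜 C V - V) m W‖
      ≤ ∑ W ∈ univ.filter (fun W : Fin m → Γ => W i = w), (wt (univ.image W) * ‖kernel 𝕜 (gaussConv 𝕜 C V - V) m W‖ +
          wt (univ.image W) * ‖kernel 𝕜 (effAction 𝕜 C V - gaussConv 𝕜 C V) m W‖) :=
        sum_le_sum fun W _ => by
          rw [hsplit W, ← mul_add]
          exact mul_le_mul_of_nonneg_left (norm_add_le _ _) (hwt.nonneg _)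
    _ = _ := by rw [sum_add_distrib]
    _ ≤ 0 + _ := add_le_add h2 h3'
    _ = _ := zero_add _

end Literature.MathematicalPhysics.QuantumLattice
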